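import Mathlib.Algebra.MvPolynomial.Funext
import Mathlib.Algebra.CharZero.Infinite
import Literature.Barriers.ValiantsHypothesis.AlgebraicNaturalProofs
import Literature.Computability.AlgebraicComplexity.CoefficientExtraction
import Literature.Computability.AlgebraicComplexity.StandardFamilies
import HarnessLib

/-!
# Algebraically natural proofs: the PLANTING OBSTRUCTION — a jointly `VP`-succinct generator cannot
# carry the hard permanent in any coordinate (cell `valiant-natproofs`, planner p1 §5, W3)

Companion to `AlgebraicNaturalProofsGenerators.lean` / `…KRST.lean`. Kumar–Ramya–Saptharishi–Tengse
2022 obtain their `VNP` theorem from ONE polynomial `F_{n,a,p}(x, z) ∈ VNP` whose `x`-coefficients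
are the coordinates `Perm_[p](z|_{S_e})` of the Kabanets–Impagliazzo generator (§3.4: "every
coefficient of `F^{≤d}` is `Perm_[p](z_S)` for some `S` in the design"). The `VP` analogue of this
JOINT succinctness — one circuit `Γ(x, z)` of size `n^b` whose seed specialisations `Γ(x, a)` have
degree `≤ n` and coefficient vectors `G(a)` (FSV Def. 7 (1)–(2) with `𝒞' = 𝒞 = VP`) — is
incompatible with planting a hard permanent at ANY coordinate: the coefficient functions of `Γ`
are cheap (`CoefficientExtraction.lean`: `L([x^e] Γ) ≤ (n+1)^n (L(Γ) + 2)` by interpolation), so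
`L(per_M) ≤ (n+1)^n (n^b + 2) < 2^{n³}`, contradicting exponential hardness at `M = (n³)^c`.
(The planner's kernel theorem covered the constant coordinate `e = 0`, a projection; the
general coordinate was typed `GeneralPlantingObstruction` pending Baur–Strassen — interpolation
replaces it, at the price of `M = (n³)^c` for `(n²)^c`.)

* `seedSpec Γ a`, `JointlySuccinct F n q b G`, `PlantsPermanentAt F n q M e G` — the planner's
  definitions (HOME/p1/Chain.lean §4–5), over a general field;
* `map_eval_sumAlgEquiv` / `eval_coeff_sumAlgEquiv` — specialising the seed commutes with taking
  `x`-coefficients; `degreeOf_sumAlgEquiv_le_of_seedSpec` — if every specialisation has degree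
  `≤ n` then `Γ` has `x`-degrees `≤ n` (infinite field); `coord_eq_coeff_of_jointlySuccinct` —
  the coordinates of a jointly succinct generator ARE the coefficient functions of `Γ`;
* `complexity_coord_le_of_jointlySuccinct` — `L(G e) ≤ (n+1)^n (n^b + 2)`;
* `not_jointlySuccinct_of_plantsPermanentAt` — **the obstruction**: under
  `2^j ≤ L(per_{j^c})` (`j ≥ m₀`), for every `b`, eventually in `n`, no generator planting
  `per_{(n³)^c}` at any coordinate is jointly `n^b`-succinct.

## References

* [KumarRamyaSaptharishiTengse2022] M. Kumar, C. Ramya, R. Saptharishi, A. Tengse, *If VNP is hard,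
  then so are equations for it*, STACS 2022, §3.4–3.5 and §4 ("does not appear to extend to VP").
* [ForbesShpilkaVolk2018] M. A. Forbes, A. Shpilka, B. L. Volk, Theory Comput. 14 (2018), Def. 7.
* [Burgisser2000] P. Bürgisser, *Completeness and Reduction in Algebraic Complexity Theory*, Rem. 2.7.
-/

noncomputable section

namespace Literature.Barriers.ValiantsHypothesis

open Literature.Computability.AlgebraicComplexity MvPolynomial

section Defs

variable (F : Type*) [Field F]

/-- The seed specialisation `Γ(x, a) ∈ F[x]` of `Γ(x, z) ∈ F[x ⊕ z]`. [cite: ForbesShpilkaVolk2018, Def. 7] -/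
def seedSpec {n q : ℕ} (Γ : MvPolynomial (Fin n ⊕ Fin q) F) (a : Fin q → F) :
    MvPolynomial (Fin n) F :=
  aeval (Sum.elim X fun j => C (a j)) Γ

/-- **Jointly (`VP`-)succinct generator** (FSV Def. 7 (1)–(2) two-sorted, as in the planner's
`JointlySuccinct`): ONE polynomial `Γ(x, z)` of circuit size `≤ n^b` whose specialisations
`Γ(x, a)` have degree `≤ n` and coefficient vectors `G(a)`. [cite: ForbesShpilkaVolk2018, Def. 7] -/
def JointlySuccinct (n q b : ℕ) (G : degLEMonomials n → MvPolynomial (Fin q) F) : Prop :=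
  ∃ Γ : MvPolynomial (Fin n ⊕ Fin q) F, complexity Γ ≤ n ^ b ∧
    ∀ a : Fin q → F, (seedSpec F Γ a).totalDegree ≤ n ∧
      ∀ m : degLEMonomials n, coeff (m : Fin n →₀ ℕ) (seedSpec F Γ a) = eval a (G m)

/-- **Planting**: coordinate `e` of `G` IS the permanent `per_M` on an `M × M` block of the seed
variables (the shape of every coordinate of `KI-gen(per_M)`, KRST §3.4).
[cite: KumarRamyaSaptharishiTengse2022, §3.4] -/
def PlantsPermanentAt (n q M : ℕ) (e : degLEMonomials n)
    (G : degLEMonomials n → MvPolynomial (Fin q) F) : Prop :=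
  ∃ ι : Fin M × Fin M → Fin q, Function.Injective ι ∧ G e = rename ι (perPoly (Fin M) F)

end Defs

section Bridge

variable {F : Type*} [Field F] {n q : ℕ}

/-- Specialising the seed commutes with the two-sorted reading: `map (eval a) (sumAlgEquiv Γ) =
Γ(x, a)`. [cite: Burgisser2000, Rem. 2.7] -/
theorem map_eval_sumAlgEquiv (Γ : MvPolynomial (Fin n ⊕ Fin q) F) (a : Fin q → F) :
    MvPolynomial.map (eval a) (sumAlgEquiv F (Fin n) (Fin q) Γ) = seedSpec F Γ a := by
  have key : (MvPolynomial.map (eval a)).comp (sumAlgEquiv F (Fin n) (Fin q)).toRingEquiv.toRingHom =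
      (aeval (Sum.elim X fun j => C (a j)) :
        MvPolynomial (Fin n ⊕ Fin q) F →ₐ[F] MvPolynomial (Fin n) F).toRingHom := by
    refine MvPolynomial.ringHom_ext (fun r => ?_) (fun v => ?_)
    · simp only [RingHom.coe_comp, Function.comp_apply, RingEquiv.toRingHom_eq_coe,
        RingEquiv.coe_toRingHom, AlgEquiv.coe_ringEquiv, AlgHom.toRingHom_eq_coe,
        AlgHom.coe_toRingHom, aeval_C, algebraMap_eq]
      rw [sumAlgEquiv_C_inl, map_C, eval_C]
    · rcases v with i | j
      · simp only [RingHom.coe_comp, Function.comp_apply, RingEquiv.toRingHom_eq_coe,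
          RingEquiv.coe_toRingHom, AlgEquiv.coe_ringEquiv, AlgHom.toRingHom_eq_coe,
          AlgHom.coe_toRingHom, aeval_X, Sum.elim_inl]
        rw [sumAlgEquiv_X_inl, map_X]
      · simp only [RingHom.coe_comp, Function.comp_apply, RingEquiv.toRingHom_eq_coe,
          RingEquiv.coe_toRingHom, AlgEquiv.coe_ringEquiv, AlgHom.toRingHom_eq_coe,
          AlgHom.coe_toRingHom, aeval_X, Sum.elim_inr]
        rw [sumAlgEquiv_X_inr, map_C, eval_X]
  exact RingHom.congr_fun key Γ

/-- Coefficientwise: `([x^m] Γ)(a) = [x^m] Γ(x, a)`. [cite: Burgisser2000, Rem. 2.7] -/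
theorem eval_coeff_sumAlgEquiv (Γ : MvPolynomial (Fin n ⊕ Fin q) F) (a : Fin q → F)
    (m : Fin n →₀ ℕ) :
    eval a (coeff m (sumAlgEquiv F (Fin n) (Fin q) Γ)) = coeff m (seedSpec F Γ a) := by
  rw [← map_eval_sumAlgEquiv, coeff_map]

variable [Infinite F]

/-- If every seed specialisation has degree `≤ n`, the two-sorted polynomial has all `x`-exponents
`≤ n` (a coefficient function vanishing at every seed is zero: infinite field).
[cite: ForbesShpilkaVolk2018, Def. 7] -/
theorem degreeOf_sumAlgEquiv_le_of_seedSpec (Γ : MvPolynomial (Fin n ⊕ Fin q) F)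
    (h : ∀ a : Fin q → F, (seedSpec F Γ a).totalDegree ≤ n) (i : Fin n) :
    degreeOf i (sumAlgEquiv F (Fin n) (Fin q) Γ) ≤ n := by
  classical
  rw [degreeOf_le_iff]
  intro s hs
  by_contra hlt
  push Not at hlt
  -- the coefficient function of `x^s` vanishes at every seed, hence is zero
  have hzero : coeff s (sumAlgEquiv F (Fin n) (Fin q) Γ) = 0 := by
    apply MvPolynomial.funext
    intro a
    rw [map_zero, eval_coeff_sumAlgEquiv]
    -- `deg Γ(x,a) ≤ n < s i ≤ |s|`
    by_contra hne
    have hmem : s ∈ (seedSpec F Γ a).support := mem_support_iff.2 hne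
    have h1 : s i ≤ (seedSpec F Γ a).totalDegree :=
      (Finsupp.le_degree i s).trans (by
        have := le_totalDegree hmem
        rwa [Finsupp.degree_apply] )
    exact absurd ((h1.trans (h a))) (not_le.2 hlt)
  exact (mem_support_iff.1 hs) hzero

/-- **Coordinates are coefficient functions**: for a jointly succinct witness `Γ`, `G e = [x^e] Γ`
as polynomials in the seed. [cite: ForbesShpilkaVolk2018, Def. 7] -/
theorem coord_eq_coeff_of_spec {Γ : MvPolynomial (Fin n ⊕ Fin q) F}
    {G : degLEMonomials n → MvPolynomial (Fin q) F}
    (h : ∀ a : Fin q → F, ∀ m : degLEMonomials n,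
      coeff (m : Fin n →₀ ℕ) (seedSpec F Γ a) = eval a (G m)) (e : degLEMonomials n) :
    G e = coeff (e : Fin n →₀ ℕ) (sumAlgEquiv F (Fin n) (Fin q) Γ) := by
  apply MvPolynomial.funext
  intro a
  rw [eval_coeff_sumAlgEquiv, h a e]

end Bridge

section Obstruction

variable {F : Type*} [Field F] [CharZero F] {n q : ℕ}

/-- **Coordinates of a jointly succinct generator are cheap**: `L(G e) ≤ (n+1)^n (n^b + 2)` for
every coordinate `e` (interpolation, `complexity_coeff_sumAlgEquiv_le`).
[cite: Burgisser2000, Rem. 2.7] -/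
theorem complexity_coord_le_of_jointlySuccinct {b : ℕ} {G : degLEMonomials n → MvPolynomial (Fin q) F}
    (hJ : JointlySuccinct F n q b G) (e : degLEMonomials n) :
    complexity (G e) ≤ (n + 1) ^ n * (n ^ b + 2) := by
  obtain ⟨Γ, hΓ, hspec⟩ := hJ
  rw [coord_eq_coeff_of_spec (fun a m => (hspec a).2 m) e]
  refine (complexity_coeff_sumAlgEquiv_le Γ
    (degreeOf_sumAlgEquiv_le_of_seedSpec Γ fun a => (hspec a).1) _).trans ?_
  exact Nat.mul_le_mul_left _ (by omega)

/-- Growth: `(n+1)^n (n^b + 2) < 2^{n³}` eventually. [folklore] -/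
private theorem eventually_pow_bound (b : ℕ) :
    ∃ n₀ : ℕ, ∀ n : ℕ, n₀ ≤ n → (n + 1) ^ n * (n ^ b + 2) < 2 ^ (n ^ 3) := by
  refine ⟨b + 3, fun n hn => ?_⟩
  have hn1 : 1 ≤ n := by omega
  have h1 : (n + 1) ^ n ≤ 2 ^ (n ^ 2) := by
    calc (n + 1) ^ n ≤ (2 ^ n) ^ n := Nat.pow_le_pow_left Nat.lt_two_pow_self n
      _ = 2 ^ (n ^ 2) := by rw [← pow_mul, sq]
  have h2 : n ^ b + 2 < 2 ^ (n ^ 2) := by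
    have hb : n ^ b ≤ (2 ^ n) ^ b := Nat.pow_le_pow_left (Nat.lt_two_pow_self).le b
    have hb' : (2 ^ n) ^ b = 2 ^ (n * b) := by rw [← pow_mul]
    have hnb : n * b + 2 ≤ n ^ 2 := by nlinarith
    have h3 : 2 ^ (n * b) * 2 ^ 2 ≤ 2 ^ (n ^ 2) := by
      rw [← pow_add]; exact Nat.pow_le_pow_right (by norm_num) hnb
    have h4 : 1 ≤ 2 ^ (n * b) := Nat.one_le_two_pow
    omega
  have h5 : n ^ 2 + n ^ 2 ≤ n ^ 3 := by nlinarith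
  calc (n + 1) ^ n * (n ^ b + 2) < 2 ^ (n ^ 2) * 2 ^ (n ^ 2) := by
        exact Nat.mul_lt_mul_of_le_of_lt h1 h2 (by positivity)
    _ = 2 ^ (n ^ 2 + n ^ 2) := by rw [← pow_add]
    _ ≤ 2 ^ (n ^ 3) := Nat.pow_le_pow_right (by norm_num) h5

/-- **The planting obstruction (any coordinate).** If `2^j ≤ L(per_{j^c})` for all `j ≥ m₀`
(exponential hardness of the permanent, ℕ-form), then for every `b`, eventually in `n`, NO
polynomial map planting `per_{(n³)^c}` at some coordinate is jointly `n^b`-succinct: the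
Kabanets–Impagliazzo / KRST generator shape can never supply a jointly `VP`-succinct fooling
generator — "the proof does not appear to extend to VP" made quantitative.
[cite: KumarRamyaSaptharishiTengse2022, §4] -/
theorem not_jointlySuccinct_of_plantsPermanentAt {c m₀ : ℕ}
    (hper : ∀ j : ℕ, m₀ ≤ j → 2 ^ j ≤ complexity (perPoly (Fin (j ^ c)) F)) (b : ℕ) :
    ∃ n₀ : ℕ, ∀ n : ℕ, n₀ ≤ n → ∀ (q : ℕ) (G : degLEMonomials n → MvPolynomial (Fin q) F)
      (e : degLEMonomials n), PlantsPermanentAt F n q ((n ^ 3) ^ c) e G →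
        ¬ JointlySuccinct F n q b G := by
  obtain ⟨n₁, hn₁⟩ := eventually_pow_bound b
  refine ⟨max n₁ (max m₀ 1), fun n hn q G e hP hJ => ?_⟩
  obtain ⟨ι, hι, hGe⟩ := hP
  have h1 : n₁ ≤ n := (le_max_left _ _).trans hn
  have hm₀ : m₀ ≤ n ^ 3 := by
    have : m₀ ≤ n := (le_max_left _ _).trans ((le_max_right _ _).trans hn)
    have h1' : 1 ≤ n := (le_max_right _ _).trans ((le_max_right _ _).trans hn)
    calc m₀ ≤ n := this
      _ = n * 1 * 1 := by ring
      _ ≤ n * n * n := by gcongr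
      _ = n ^ 3 := by ring
  have hhard := hper (n ^ 3) hm₀
  have hcoord := complexity_coord_le_of_jointlySuccinct hJ e
  rw [hGe, complexity_rename_of_injective_holds hι] at hcoord
  have hlt := hn₁ n h1
  omega

end Obstruction

end Literature.Barriers.ValiantsHypothesis

end
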